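import Summits.ResolutionOfSingularities.ResolutionOfSingularities.Theorems.DeltaCutSing3
import HarnessLib

/-!
# DeltaCutSingCells — tree file 4/6 of the decomp-res lens-6 g30 node «SingCut» (HOME `decomp-res-lens-6/g30/SingCut.lean` + `SingCutCertificates.lean`)

§SCells — the cells `WORTopGHeavySTame` (DECIDED, from five) / `WORTopSHeavy` (LOCATED RESIDUAL) (+ `E1` families), the EXACT
hypothesis-free carve `worTopGHeavy_iff_sHeavy_sTame` / `e1TopGHeavy_iff_sHeavy_sTame`, `worTopGHeavySTame_of_five`, the RE-LOCATION
`e1TopGHeavy_iff_e1TopSHeavy (h5 : E 5)`, the edges down to `E 1` (`e_one_iff_e1TopSHeavy`), the residual's two kinds `WORTopSFrozen`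
(F-ss²) / `WORTopSPerpetual` (P‴) with the exact carve `worTopSHeavy_iff_singSing_perpetual`, the intrinsic reading, and g28's kinds
RE-READ (`worTopGFrozen_of_sCells`, `worTopGFrozen_of_sFrozen_sPerpetual`, `worTopGPerpetual_of_sPerpetual`, `gFrozen_sing_sMoves'`).
The module docstring of `DeltaCutSing` (file 1/6) carries the node's summary (the law, the letters, the cells, the honest ceiling and
the sources); `NODE-g30.md` (HOME) is the record.  Same namespace `…Theorems.DeltaCutClasses`, declarations verbatim from the lens
file. [new] [folklore]
-/

noncomputable section

open CategoryTheory CategoryTheory.Limits AlgebraicGeometry TopologicalSpace IsLocalRing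
open Literature.AlgebraicGeometry.Resolution

universe u

namespace Summit.ResolutionOfSingularities.ResolutionOfSingularities.Theorems.DeltaCutClasses

open Summit.ResolutionOfSingularities.ResolutionOfSingularities.Theorems.TwistCutClasses
open Summit.ResolutionOfSingularities.ResolutionOfSingularities.Theorems.LightCutClasses

section SCells

open Summit.ResolutionOfSingularities.ResolutionOfSingularities.Theorems
open WeakOrderReduction ForcedTowerClasses SubfieldContactClasses AbsoluteContactClasses PurityValveClasses

/-! ### §SCells — THE CELLS OF THE SINGULAR CUT: the EXACT hypothesis-free carve of `WORTopGHeavy` / `E1TopGHeavy` (binders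
VERBATIM), the decided side PROVED from five, the RE-LOCATION of the residual, the edges down to `E 1`, the residual's two
kinds F-ss² / P‴, and g28's two kinds RE-READ -/

/-- **THE DECIDED CELL · `WORTopGHeavySTame n`** — weak resolution for g28's residual base data at marking `n` (canonical bad
run, separating run, refined run AND graded run not terminating) whose SINGULAR RUN TERMINATES.  DECIDED (PROVED below from
`SeqDimFour 5 n` by `wor_of_sTerminates`; INHABITED by H = `z³ + (t²w − u²)⁴` and D′₃ = `z³ + u·t³w³`, char 3:
`SingCutCertificates`). -/
def WORTopGHeavySTame (n : ℕ) : Prop :=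
  ∀ p : ℕ, p.Prime → ∀ (k : Type) [Field k] [CharP k p] (Y : Scheme.{0}) (g : Y ⟶ Spec (.of k)),
    IsBase Y g → ∀ M : MarkedIdeal Y, IsDatum n M → TopHeavy Y M.ideal n → TopDeltaHeavy Y M.ideal n →
      TopChainHeavy Y M.ideal n → ¬ RunTerminates n ⟨Y, M.ideal⟩ → ¬ SepTerminates n ⟨Y, M.ideal⟩ →
        ¬ RefTerminates n ⟨⟨Y, M.ideal⟩, none⟩ → ¬ GTerminates n ⟨⟨Y, M.ideal⟩, none⟩ →
          STerminates n ⟨⟨Y, M.ideal⟩, none⟩ → ∃ t : CentreSeq Y, WeakResolution t M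

/-- **THE RESIDUAL CELL · `WORTopSHeavy n`** — weak resolution for g28's residual base data at marking `n` whose SINGULAR RUN does
NOT terminate either (it FREEZES at a nonempty bad locus whose irregular non-curve reduced closure has an irregular surface part
WITH IRREGULAR Sing-closure — kind F-ss², INHABITED by T₃ = `z³ + (tuw)⁴` —, or is PERPETUAL — kind P‴, no inhabitant known;
exact: `not_sTerminates_iff`).  RESIDUAL (the located successor of `WORTopGHeavy n`). -/
def WORTopSHeavy (n : ℕ) : Prop :=
  ∀ p : ℕ, p.Prime → ∀ (k : Type) [Field k] [CharP k p] (Y : Scheme.{0}) (g : Y ⟶ Spec (.of k)),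
    IsBase Y g → ∀ M : MarkedIdeal Y, IsDatum n M → TopHeavy Y M.ideal n → TopDeltaHeavy Y M.ideal n →
      TopChainHeavy Y M.ideal n → ¬ RunTerminates n ⟨Y, M.ideal⟩ → ¬ SepTerminates n ⟨Y, M.ideal⟩ →
        ¬ RefTerminates n ⟨⟨Y, M.ideal⟩, none⟩ → ¬ GTerminates n ⟨⟨Y, M.ideal⟩, none⟩ →
          ¬ STerminates n ⟨⟨Y, M.ideal⟩, none⟩ → ∃ t : CentreSeq Y, WeakResolution t M

/-- **THE DECIDED family · `E1TopGHeavySTame`**. DECIDED. -/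
def E1TopGHeavySTame : Prop := ∀ n : ℕ, 1 ≤ n → WORTopGHeavySTame n

/-- **THE RESIDUAL (family) · `E1TopSHeavy`** — THE LOCATED RESIDUAL of the lens-6 column after g30. RESIDUAL. -/
def E1TopSHeavy : Prop := ∀ n : ℕ, 1 ≤ n → WORTopSHeavy n

/-- **EXACT CARVE at one marking** (hypothesis-free): `WORTopGHeavy n ⟺ WORTopSHeavy n ∧ WORTopGHeavySTame n` (excluded middle on
`STerminates`). [new] [folklore] -/
theorem worTopGHeavy_iff_sHeavy_sTame (n : ℕ) : WORTopGHeavy n ↔ WORTopSHeavy n ∧ WORTopGHeavySTame n := by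
  constructor
  · intro h
    exact ⟨fun p hp k _ _ Y g hB M hM hT hD hC hr hs hf hg _ => h p hp k Y g hB M hM hT hD hC hr hs hf hg,
      fun p hp k _ _ Y g hB M hM hT hD hC hr hs hf hg _ => h p hp k Y g hB M hM hT hD hC hr hs hf hg⟩
  · rintro ⟨hR, hD⟩ p hp k _ _ Y g hB M hM hT hDH hC hr hs hf hg
    by_cases ht : STerminates n ⟨⟨Y, M.ideal⟩, none⟩
    · exact hD p hp k Y g hB M hM hT hDH hC hr hs hf hg ht
    · exact hR p hp k Y g hB M hM hT hDH hC hr hs hf hg ht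

/-- **EXACT CARVE of the family** (hypothesis-free): `E1TopGHeavy ⟺ E1TopSHeavy ∧ E1TopGHeavySTame`. [new] [folklore] -/
theorem e1TopGHeavy_iff_sHeavy_sTame : E1TopGHeavy ↔ E1TopSHeavy ∧ E1TopGHeavySTame := by
  constructor
  · intro h
    exact ⟨fun n hn => ((worTopGHeavy_iff_sHeavy_sTame n).1 (h n hn)).1,
      fun n hn => ((worTopGHeavy_iff_sHeavy_sTame n).1 (h n hn)).2⟩
  · rintro ⟨hR, hD⟩ n hn
    exact (worTopGHeavy_iff_sHeavy_sTame n).2 ⟨hR n hn, hD n hn⟩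

/-- **THE DECIDED CELL IS PROVED from `SeqDimFour 5 n`.** [new] [folklore] -/
theorem worTopGHeavySTame_of_five {n : ℕ} (hn : 1 ≤ n) (h5 : SeqDimFour 5 n) : WORTopGHeavySTame n :=
  fun p hp k _ _ Y g hB M hM _ _ _ _ _ _ _ hS => wor_of_sTerminates hn h5 p hp k Y g hB M hM hS

/-- **THE DECIDED family is PROVED from `E 5`** (tree: `E 5` ⟸ CJS (R), `e_five_of_RCJS`). [new] [folklore] -/
theorem e1TopGHeavySTame_of_five (h5 : E 5) : E1TopGHeavySTame := fun n hn => worTopGHeavySTame_of_five hn (h5 n hn)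

/-- **RE-LOCATION OF THE RESIDUAL (rule (C))**: under `E 5`, `E1TopGHeavy ⟺ E1TopSHeavy` — g28's located residual is EQUIVALENT to
its typed sub-class «the singular run does not terminate either», STRICTLY smaller as a class of data (H and D′₃ are
graded-FROZEN — kind F-surf-sing — and singular-DECIDED at s-height `2`: `SingCutCertificates`). [new] [folklore] -/
theorem e1TopGHeavy_iff_e1TopSHeavy (h5 : E 5) : E1TopGHeavy ↔ E1TopSHeavy :=
  ⟨fun h => (e1TopGHeavy_iff_sHeavy_sTame.1 h).1, fun h => e1TopGHeavy_iff_sHeavy_sTame.2 ⟨h, e1TopGHeavySTame_of_five h5⟩⟩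

/-- Per marking: under `SeqDimFour 5 n`, `WORTopGHeavy n ⟺ WORTopSHeavy n`. [new] [folklore] -/
theorem worTopGHeavy_iff_worTopSHeavy {n : ℕ} (hn : 1 ≤ n) (h5 : SeqDimFour 5 n) : WORTopGHeavy n ↔ WORTopSHeavy n :=
  ⟨fun h => ((worTopGHeavy_iff_sHeavy_sTame n).1 h).1,
    fun h => (worTopGHeavy_iff_sHeavy_sTame n).2 ⟨h, worTopGHeavySTame_of_five hn h5⟩⟩

/-- g27's residual: under `E 5`, `E1TopRefHeavy ⟺ E1TopSHeavy`. [new] [folklore] -/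
theorem e1TopRefHeavy_iff_e1TopSHeavy (h5 : E 5) : E1TopRefHeavy ↔ E1TopSHeavy :=
  (e1TopRefHeavy_iff_e1TopGHeavy h5).trans (e1TopGHeavy_iff_e1TopSHeavy h5)

/-- Per marking: under `SeqDimFour 5 n`, `WORTopRefHeavy n ⟺ WORTopSHeavy n`. [new] [folklore] -/
theorem worTopRefHeavy_iff_worTopSHeavy {n : ℕ} (hn : 1 ≤ n) (h5 : SeqDimFour 5 n) : WORTopRefHeavy n ↔ WORTopSHeavy n :=
  (worTopRefHeavy_iff_worTopGHeavy hn h5).trans (worTopGHeavy_iff_worTopSHeavy hn h5)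

/-- g26's residual: under `E 5`, `E1TopSepHeavy ⟺ E1TopSHeavy`. [new] [folklore] -/
theorem e1TopSepHeavy_iff_e1TopSHeavy (h5 : E 5) : E1TopSepHeavy ↔ E1TopSHeavy :=
  (e1TopSepHeavy_iff_e1TopGHeavy h5).trans (e1TopGHeavy_iff_e1TopSHeavy h5)

/-- g25's residual: under `E 5`, `E1TopRunHeavy ⟺ E1TopSHeavy`. [new] [folklore] -/
theorem e1TopRunHeavy_iff_e1TopSHeavy (h5 : E 5) : E1TopRunHeavy ↔ E1TopSHeavy :=
  (e1TopRunHeavy_iff_e1TopGHeavy h5).trans (e1TopGHeavy_iff_e1TopSHeavy h5)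

/-- g24's residual: under `E 5`, `E1TopChainHeavy ⟺ E1TopSHeavy`. [new] [folklore] -/
theorem e1TopChainHeavy_iff_e1TopSHeavy (h5 : E 5) : E1TopChainHeavy ↔ E1TopSHeavy :=
  (e1TopChainHeavy_iff_e1TopGHeavy h5).trans (e1TopGHeavy_iff_e1TopSHeavy h5)

/-- g23's residual: under `E 5`, `E1TopDeltaHeavy ⟺ E1TopSHeavy`. [new] [folklore] -/
theorem e1TopDeltaHeavy_iff_e1TopSHeavy (h5 : E 5) : E1TopDeltaHeavy ↔ E1TopSHeavy :=
  (e1TopDeltaHeavy_iff_e1TopGHeavy h5).trans (e1TopGHeavy_iff_e1TopSHeavy h5)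

/-- **THE WHOLE COLUMN after g30**: under `E 5`, `E1TopHeavy ⟺ E1TopSHeavy`. [new] [folklore] -/
theorem e1TopHeavy_iff_e1TopSHeavy (h5 : E 5) : E1TopHeavy ↔ E1TopSHeavy :=
  (e1TopHeavy_iff_e1TopGHeavy h5).trans (e1TopGHeavy_iff_e1TopSHeavy h5)

/-- **DOWN-LINK TO ITEM 26971's CLASS**: under `SubfieldContactAbs` and `E 5`, `E1TopNoAbs ⟺ E1TopSHeavy`. [new] [folklore] -/
theorem e1TopNoAbs_iff_e1TopSHeavy (hSC : SubfieldContactAbs) (h5 : E 5) : E1TopNoAbs ↔ E1TopSHeavy :=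
  (e1TopNoAbs_iff_e1TopGHeavy hSC h5).trans (e1TopGHeavy_iff_e1TopSHeavy h5)

/-- **SUMMIT EDGE after g30**: under `SubfieldContactAbs` and `E 5`, `E 1 ⟺ E1TopSHeavy` — the column's ONE open statement is the
singular residual. [new] [folklore] -/
theorem e_one_iff_e1TopSHeavy (hSC : SubfieldContactAbs) (h5 : E 5) : E 1 ↔ E1TopSHeavy :=
  (e_one_iff_e1TopGHeavy hSC h5).trans (e1TopGHeavy_iff_e1TopSHeavy h5)

/-- **RESIDUAL SUB-CELL of KIND F-ss² · `WORTopSFrozen n`** — the singular run FREEZES: at its first motionless level nothing is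
pending, the bad locus is NONEMPTY, its reduced closure is irregular, not a curve, its surface part is irregular AND THE REDUCED
CLOSURE OF THE SINGULAR LOCUS OF THE SURFACE PART IS ITSELF IRREGULAR (INHABITED: T₃ = `z³ + (tuw)⁴`, char 3, whose bad closure
is the union of the three coordinate planes of `V(z)`, singular along the three concurrent coordinate axes).  RESIDUAL (kind
F-ss²). -/
def WORTopSFrozen (n : ℕ) : Prop :=
  ∀ p : ℕ, p.Prime → ∀ (k : Type) [Field k] [CharP k p] (Y : Scheme.{0}) (g : Y ⟶ Spec (.of k)),
    IsBase Y g → ∀ M : MarkedIdeal Y, IsDatum n M → TopHeavy Y M.ideal n → TopDeltaHeavy Y M.ideal n →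
      TopChainHeavy Y M.ideal n → ¬ RunTerminates n ⟨Y, M.ideal⟩ → ¬ SepTerminates n ⟨Y, M.ideal⟩ →
        ¬ RefTerminates n ⟨⟨Y, M.ideal⟩, none⟩ → ¬ GTerminates n ⟨⟨Y, M.ideal⟩, none⟩ →
          SFrozen n ⟨⟨Y, M.ideal⟩, none⟩ → ∃ t : CentreSeq Y, WeakResolution t M

/-- **RESIDUAL SUB-CELL of KIND P‴ · `WORTopSPerpetual n`** — the singular run is PERPETUAL (every level moves forever; contains
g28's kind P″ by `GPerpetual.sPerpetual`; no inhabitant known, none claimed).  RESIDUAL (kind P‴). -/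
def WORTopSPerpetual (n : ℕ) : Prop :=
  ∀ p : ℕ, p.Prime → ∀ (k : Type) [Field k] [CharP k p] (Y : Scheme.{0}) (g : Y ⟶ Spec (.of k)),
    IsBase Y g → ∀ M : MarkedIdeal Y, IsDatum n M → TopHeavy Y M.ideal n → TopDeltaHeavy Y M.ideal n →
      TopChainHeavy Y M.ideal n → ¬ RunTerminates n ⟨Y, M.ideal⟩ → ¬ SepTerminates n ⟨Y, M.ideal⟩ →
        ¬ RefTerminates n ⟨⟨Y, M.ideal⟩, none⟩ → ¬ GTerminates n ⟨⟨Y, M.ideal⟩, none⟩ →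
          SPerpetual n ⟨⟨Y, M.ideal⟩, none⟩ → ∃ t : CentreSeq Y, WeakResolution t M

/-- RESIDUAL kind-F-ss² family. RESIDUAL. -/
def E1TopSFrozen : Prop := ∀ n : ℕ, 1 ≤ n → WORTopSFrozen n

/-- RESIDUAL kind-P‴ family. RESIDUAL. -/
def E1TopSPerpetual : Prop := ∀ n : ℕ, 1 ≤ n → WORTopSPerpetual n

/-- **EXACT CARVE OF THE RESIDUAL INTO ITS TWO KINDS** (hypothesis-free; `s_trichotomy` + exclusivity):
`WORTopSHeavy n ⟺ WORTopSFrozen n ∧ WORTopSPerpetual n`. [new] [folklore] -/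
theorem worTopSHeavy_iff_singSing_perpetual (n : ℕ) : WORTopSHeavy n ↔ WORTopSFrozen n ∧ WORTopSPerpetual n := by
  constructor
  · intro h
    exact ⟨fun p hp k _ _ Y g hB M hM hT hD hC hr hs hf hg hF =>
        h p hp k Y g hB M hM hT hD hC hr hs hf hg ((not_sTerminates_iff n ⟨⟨Y, M.ideal⟩, none⟩).2 (Or.inl hF)),
      fun p hp k _ _ Y g hB M hM hT hD hC hr hs hf hg hP =>
        h p hp k Y g hB M hM hT hD hC hr hs hf hg ((not_sTerminates_iff n ⟨⟨Y, M.ideal⟩, none⟩).2 (Or.inr hP))⟩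
  · rintro ⟨hF, hP⟩ p hp k _ _ Y g hB M hM hT hD hC hr hs hf hg ht
    rcases (not_sTerminates_iff n ⟨⟨Y, M.ideal⟩, none⟩).1 ht with h | h
    · exact hF p hp k Y g hB M hM hT hD hC hr hs hf hg h
    · exact hP p hp k Y g hB M hM hT hD hC hr hs hf hg h

/-- the same for the families: `E1TopSHeavy ⟺ E1TopSFrozen ∧ E1TopSPerpetual`. [new] [folklore] -/
theorem e1TopSHeavy_iff_singSing_perpetual : E1TopSHeavy ↔ E1TopSFrozen ∧ E1TopSPerpetual := by
  constructor
  · intro h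
    exact ⟨fun n hn => ((worTopSHeavy_iff_singSing_perpetual n).1 (h n hn)).1,
      fun n hn => ((worTopSHeavy_iff_singSing_perpetual n).1 (h n hn)).2⟩
  · rintro ⟨hF, hP⟩ n hn
    exact (worTopSHeavy_iff_singSing_perpetual n).2 ⟨hF n hn, hP n hn⟩

/-- **THE SINGULAR TERMINATION TEST SUBSUMES THE GRADED ONE**: `¬ STerminates ⟹ ¬ GTerminates` — so the residual binder
`¬ GTerminates` of `WORTopSHeavy` is implied by `¬ STerminates` (kept VERBATIM for the carve). [new] [folklore] -/
theorem not_gTerminates_of_not_sTerminates {n : ℕ} {R : RefStage} (h : ¬ STerminates n R) : ¬ GTerminates n R :=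
  fun hg => h hg.sTerminates

/-- **THE RESIDUAL READ INTRINSICALLY**: `WORTopSHeavy n` is weak resolution for ALL base `n`-data whose canonical bad run,
separating run, refined run, graded run AND singular run all fail to terminate — the three g23–g25 heaviness binders are
implied. [new] [folklore] -/
theorem worTopSHeavy_iff_intrinsic {n : ℕ} (hn : 1 ≤ n) :
    WORTopSHeavy n ↔
      ∀ p : ℕ, p.Prime → ∀ (k : Type) [Field k] [CharP k p] (Y : Scheme.{0}) (g : Y ⟶ Spec (.of k)),
        IsBase Y g → ∀ M : MarkedIdeal Y, IsDatum n M → ¬ RunTerminates n ⟨Y, M.ideal⟩ → ¬ SepTerminates n ⟨Y, M.ideal⟩ →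
          ¬ RefTerminates n ⟨⟨Y, M.ideal⟩, none⟩ → ¬ GTerminates n ⟨⟨Y, M.ideal⟩, none⟩ → ¬ STerminates n ⟨⟨Y, M.ideal⟩, none⟩ →
            ∃ t : CentreSeq Y, WeakResolution t M := by
  constructor
  · intro h p hp k _ _ Y g hB M hM hr hs hf hg hS
    haveI : IsLocallyNoetherian Y := isLocallyNoetherian_of_isBase hB
    have hC : TopChainHeavy Y M.ideal n := topChainHeavy_of_not_runTerminates hr
    have hD : TopDeltaHeavy Y M.ideal n := topDeltaHeavy_of_topChainHeavy hp hB hn hM hC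
    exact h p hp k Y g hB M hM (topHeavy_of_topDeltaHeavy hD) hD hC hr hs hf hg hS
  · intro h p hp k _ _ Y g hB M hM _ _ _ hr hs hf hg hS
    exact h p hp k Y g hB M hM hr hs hf hg hS

/-- **g28's KIND F-surf-sing SPLITS EXACTLY: its `SingFrozen` part IS ABSORBED BY THE DECIDED + P‴ + F-ss² CELLS** — g28's frozen
residual cell follows from the three singular cells (a graded-frozen datum is singular-terminating, singular-frozen or
singular-perpetual: `s_trichotomy`). [new] [folklore] -/
theorem worTopGFrozen_of_sCells {n : ℕ} (hD : WORTopGHeavySTame n) (hF : WORTopSFrozen n) (hP : WORTopSPerpetual n) :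
    WORTopGFrozen n := fun p hp k _ _ Y g hB M hM hT hDH hC hr hs hf hGF => by
  have hg : ¬ GTerminates n ⟨⟨Y, M.ideal⟩, none⟩ := (not_gTerminates_iff n _).2 (Or.inl hGF)
  rcases s_trichotomy n ⟨⟨Y, M.ideal⟩, none⟩ with h | h | h
  · exact hD p hp k Y g hB M hM hT hDH hC hr hs hf hg h
  · exact hF p hp k Y g hB M hM hT hDH hC hr hs hf hg h
  · exact hP p hp k Y g hB M hM hT hDH hC hr hs hf hg h

/-- under `SeqDimFour 5 n` g28's frozen cell follows from the two residual singular cells. [new] [folklore] -/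
theorem worTopGFrozen_of_sFrozen_sPerpetual {n : ℕ} (hn : 1 ≤ n) (h5 : SeqDimFour 5 n) (hF : WORTopSFrozen n)
    (hP : WORTopSPerpetual n) : WORTopGFrozen n :=
  worTopGFrozen_of_sCells (worTopGHeavySTame_of_five hn h5) hF hP

/-- **g28's KIND P″ IS A SUB-KIND OF P‴**: g28's perpetual cell follows from the singular perpetual cell (hypothesis-free,
`GPerpetual.sPerpetual`). [new] [folklore] -/
theorem worTopGPerpetual_of_sPerpetual {n : ℕ} (hP : WORTopSPerpetual n) : WORTopGPerpetual n :=
  fun p hp k _ _ Y g hB M hM hT hD hC hr hs hf hGP =>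
    hP p hp k Y g hB M hM hT hD hC hr hs hf (fun ht => ht.not_gPerpetual hGP) hGP.sPerpetual

/-- **THE SUB-KIND THEOREM at the level of cells' data**: a graded-FROZEN stage whose frozen level is `SingFrozen` has a singular
run that MOVES at the frozen level — so it is singular-terminating, singular-frozen at a LATER level with irregular Sing-closure,
or singular-perpetual, never «frozen with a regular Sing-closure». [new] [folklore] -/
theorem gFrozen_sing_sMoves' {n : ℕ} {N : Stage} {h : ℕ} (hpre : ∀ j < h, GMoves n (gRun n ⟨N, none⟩ j))
    (hP : (gRun n ⟨N, none⟩ h).pending = none) (hS : SingFrozen n (gRun n ⟨N, none⟩ h).base) :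
    SMoves n (sRun n ⟨N, none⟩ h) :=
  (gFrozen_sing_sMoves hpre hP hS).1

end SCells

end Summit.ResolutionOfSingularities.ResolutionOfSingularities.Theorems.DeltaCutClasses
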